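import Literature.Geometry.Riemannian.WassersteinW1Duality
import HarnessLib

/-!
# `d_{W₁}(ν_{x₁;s}, ν_{x₂;s}) ≤ d_t(x₁, x₂)` and the monotonicity of `d_{W₁}` between conjugate
# heat flows WITHOUT compactness of the time-slices (Bamler 2023, §3.2, Proposition (b)–(c))

R. Bamler, *Compactness theory of the space of super Ricci flows*, Invent. Math. 233 (2023), §3.2,
Proposition (comparing two conjugate heat flows): (b) *"`d^{𝒳_t}_{W₁}(μ¹_t, μ²_t)` is
non-decreasing in `t`"*, (c) *"`d^{𝒳_s}_{W₁}(ν_{x₁;s}, ν_{x₂;s})` is non-decreasing in `s` and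
`≤ d_t(x₁, x₂)`"*, and the consequences in §4 (the distance-shrinking estimate for `H`-centers,
the first half of (4.3)). `MetricFlowWassersteinMonotone.lean` proves these for COMPACT earlier
time-slices (Kantorovich–Rubinstein duality was available only on compact spaces). With the
duality inequality on complete separable metric spaces (`WassersteinW1Duality.lean`) the printed
proofs (*"Taking the supremum over all such `ũ` implies (b)"*) go through whenever the measures
have finite first moments — in particular for the conjugate heat kernels of an `H`-concentrated
flow (`Var(δ_z, ν_{x;s}) ≤ H(t − s)` at an `H`-center `z`) and for conjugate heat flows of finite
variance:

* `lintegral_edist_ne_top_of_variance_dirac_ne_top`, `IsHConcentrated.lintegral_edist_condKernel_ne_top`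
  — finite first moments;
* `wassersteinW1_condKernel_le_edist_of_ne_top`, `IsHConcentrated.wassersteinW1_condKernel_le_edist`
  — **(c)**, no compactness;
* `IsHConcentrated.wassersteinW1_condKernel_mono` — **(c)**, monotonicity;
* `IsConjugateHeatFlow.wassersteinW1_mono_of_variance_ne_top` — **(b)**;
* `IsHCenter.edist_le_edist_add'` — distance shrinking for `H`-centers (§4, before §4.1);
* `IsHConcentrated.lintegral_lintegral_edist_condKernel_le_edist'` — first half of (4.3).

Everything is proved; no definitions, no named facts.

## References

* R. H. Bamler, *Compactness theory of the space of super Ricci flows*, Invent. Math. 233 (2023),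
  §3.2, Proposition (comparing two conjugate heat flows) (b), (c); §4, display before §4.1; §4.2,
  (4.3). [Bamler2023]
* C. Villani, *Topics in Optimal Transportation*, GSM 58 (AMS 2003), Thm. 1.14. [Villani2003]
-/

noncomputable section

open Set MeasureTheory Filter Topology Metric Function
open scoped ENNReal NNReal

namespace Literature.Geometry.Riemannian

universe u

/-! ### Finite first moments -/

section Moments

variable {X : Type u} [MetricSpace X] [MeasurableSpace X] [BorelSpace X] [SecondCountableTopology X]

/-- If `Var(δ_z, μ) < ∞` for a probability measure `μ`, then all first moments `∫ d(z₀, ·) dμ` are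
finite (`∫ d(z₀, ·) ≤ d(z₀, z) + ∫ d(z, ·) ≤ d(z₀, z) + √Var(δ_z, μ)`). [folklore] -/
theorem lintegral_edist_ne_top_of_variance_dirac_ne_top (μ : Measure X) [IsProbabilityMeasure μ]
    {z : X} (hz : variance (Measure.dirac z) μ ≠ ∞) (z₀ : X) : ∫⁻ y, edist z₀ y ∂μ ≠ ∞ := by
  have h1 : ∫⁻ y, edist z y ∂μ ≤ (variance (Measure.dirac z) μ) ^ (1 / 2 : ℝ) := by
    have h := lintegral_lintegral_edist_le_sqrt_variance (Measure.dirac z) μ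
    rwa [lintegral_dirac] at h
  have h2 : ∫⁻ y, edist z₀ y ∂μ ≤ edist z₀ z + (variance (Measure.dirac z) μ) ^ (1 / 2 : ℝ) :=
    calc ∫⁻ y, edist z₀ y ∂μ ≤ ∫⁻ y, edist z₀ z + edist z y ∂μ :=
          lintegral_mono fun y ↦ edist_triangle _ _ _
      _ = edist z₀ z + ∫⁻ y, edist z y ∂μ := by
          rw [lintegral_add_left measurable_const, lintegral_const, measure_univ, mul_one]
      _ ≤ _ := add_le_add le_rfl h1
  exact ne_top_of_le_ne_top (ENNReal.add_ne_top.2 ⟨edist_ne_top _ _,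
    ENNReal.rpow_ne_top_of_nonneg (by norm_num) hz⟩) h2

/-- If `Var(μ) < ∞` for a probability measure `μ`, then all first moments are finite (some `z`
has `Var(δ_z, μ) ≤ Var(μ)`). [folklore] -/
theorem lintegral_edist_ne_top_of_variance_ne_top (μ : Measure X) [IsProbabilityMeasure μ]
    (hV : variance μ μ ≠ ∞) (z₀ : X) : ∫⁻ y, edist z₀ y ∂μ ≠ ∞ := by
  have hmeas : Measurable fun z : X ↦ ∫⁻ y, edist z y ^ 2 ∂μ :=
    (measurable_edist.pow_const 2).lintegral_prod_right'
  obtain ⟨z, hz⟩ := exists_le_lintegral (μ := μ) hmeas.aemeasurable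
  refine lintegral_edist_ne_top_of_variance_dirac_ne_top μ (z := z) ?_ z₀
  rw [variance_dirac_left]
  exact ne_top_of_le_ne_top (by rwa [← variance_def]) hz

end Moments

namespace MetricFlow

variable {I : Set ℝ} {𝒳 : MetricFlow.{u} I}

/-- In an `H`-concentrated flow the conjugate heat kernels have finite first moments:
`∫ d_s(z₀, ·) dν_{x;s} < ∞` (`Var(δ_z, ν_{x;s}) ≤ H(t − s)` at an `H`-center `z`).
[cite: Bamler2023, §3.4, Proposition (existence of H-centers)] -/
theorem IsHConcentrated.lintegral_edist_condKernel_ne_top {H : ℝ} (hH : 𝒳.IsHConcentrated H)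
    {s t : I} (hst : (s : ℝ) ≤ t) (x : 𝒳.Slice t) (z₀ : 𝒳.Slice s) :
    ∫⁻ y, edist z₀ y ∂(𝒳.condKernel x s) ≠ ∞ := by
  haveI := 𝒳.isProbabilityMeasure_condKernel x hst
  haveI : SecondCountableTopology (𝒳.Slice s) := UniformSpace.secondCountable_of_separable _
  obtain ⟨z, hz⟩ := hH.exists_isHCenter hst x
  exact lintegral_edist_ne_top_of_variance_dirac_ne_top _
    (ne_top_of_le_ne_top ENNReal.ofReal_ne_top hz.2) z₀

variable (𝒳) in
/-- **(c) without compactness**: `d_{W₁}^{𝒳_s}(ν_{x₁;s}, ν_{x₂;s}) ≤ d_t(x₁, x₂)` as soon as the two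
conjugate heat kernels have finite first moments — for every bounded `1`-Lipschitz `ũ` on `𝒳_s`
its heat flow `u_t` is `1`-Lipschitz, so `∫ ũ dν_{x₁;s} − ∫ ũ dν_{x₂;s} = u_t(x₁) − u_t(x₂) ≤
d_t(x₁, x₂)`, and Kantorovich–Rubinstein (`wassersteinW1_le_of_forall_integral_sub_le`).
[cite: Bamler2023, §3.2, Proposition (comparing two conjugate heat flows) (c)] -/
theorem wassersteinW1_condKernel_le_edist_of_ne_top {s t : I} (hst : (s : ℝ) ≤ t)
    (x₁ x₂ : 𝒳.Slice t) (z₀ : 𝒳.Slice s) (h₁ : ∫⁻ y, edist z₀ y ∂(𝒳.condKernel x₁ s) ≠ ∞)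
    (h₂ : ∫⁻ y, edist z₀ y ∂(𝒳.condKernel x₂ s) ≠ ∞) :
    wassersteinW1 (𝒳.condKernel x₁ s) (𝒳.condKernel x₂ s) ≤ edist x₁ x₂ := by
  haveI := 𝒳.isProbabilityMeasure_condKernel x₁ hst
  haveI := 𝒳.isProbabilityMeasure_condKernel x₂ hst
  haveI : SecondCountableTopology (𝒳.Slice s) := UniformSpace.secondCountable_of_separable _
  refine wassersteinW1_le_of_forall_integral_sub_le _ _ z₀ h₁ h₂ fun u hul hub ↦ ?_
  obtain ⟨C, hC⟩ := hub
  have hlip : LipschitzWith 1 (𝒳.heatFlowOf s u t) :=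
    𝒳.lipschitzWith_heatFlowOf hst hul.continuous.measurable hC hul
  rw [edist_dist]
  refine ENNReal.ofReal_le_ofReal ?_
  have h := hlip.dist_le_mul x₁ x₂
  rw [NNReal.coe_one, one_mul, Real.dist_eq, heatFlowOf_apply, heatFlowOf_apply] at h
  exact (le_abs_self _).trans h

/-- **(c) in an `H`-concentrated flow, no compactness**:
`d_{W₁}^{𝒳_s}(ν_{x₁;s}, ν_{x₂;s}) ≤ d_t(x₁, x₂)`.
[cite: Bamler2023, §3.2, Proposition (comparing two conjugate heat flows) (c)] -/
theorem IsHConcentrated.wassersteinW1_condKernel_le_edist {H : ℝ} (hH : 𝒳.IsHConcentrated H)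
    {s t : I} (hst : (s : ℝ) ≤ t) (x₁ x₂ : 𝒳.Slice t) :
    wassersteinW1 (𝒳.condKernel x₁ s) (𝒳.condKernel x₂ s) ≤ edist x₁ x₂ := by
  haveI := 𝒳.isProbabilityMeasure_condKernel x₁ hst
  -- a base point in `𝒳_s` (nonempty, as it carries a probability measure)
  have hne : Nonempty (𝒳.Slice s) := by
    by_contra hX
    rw [not_nonempty_iff] at hX
    have h1 : 𝒳.condKernel x₁ s univ = 1 := measure_univ
    rw [univ_eq_empty_iff.2 hX, measure_empty] at h1
    exact zero_ne_one h1
  obtain ⟨z₀⟩ := hne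
  exact 𝒳.wassersteinW1_condKernel_le_edist_of_ne_top hst x₁ x₂ z₀
    (hH.lintegral_edist_condKernel_ne_top hst x₁ z₀) (hH.lintegral_edist_condKernel_ne_top hst x₂ z₀)

/-- **(c), monotonicity, in an `H`-concentrated flow, no compactness**:
`s ↦ d_{W₁}^{𝒳_s}(ν_{x₁;s}, ν_{x₂;s})` is non-decreasing — for a bounded `1`-Lipschitz `ũ` on
`𝒳_{s₁}` and its heat flow `u`, `∫ ũ dν_{x₁;s₁} − ∫ ũ dν_{x₂;s₁} = ∫ u_{s₂} dν_{x₁;s₂} − ∫ u_{s₂} dν_{x₂;s₂}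
≤ d_{W₁}(s₂)` (reproduction formula, `u_{s₂}` is `1`-Lipschitz), then Kantorovich–Rubinstein.
[cite: Bamler2023, §3.2, Proposition (comparing two conjugate heat flows) (c)] -/
theorem IsHConcentrated.wassersteinW1_condKernel_mono {H : ℝ} (hH : 𝒳.IsHConcentrated H)
    {s₁ s₂ t : I} (h12 : (s₁ : ℝ) ≤ s₂) (h2t : (s₂ : ℝ) ≤ t) (x₁ x₂ : 𝒳.Slice t) :
    wassersteinW1 (𝒳.condKernel x₁ s₁) (𝒳.condKernel x₂ s₁) ≤
      wassersteinW1 (𝒳.condKernel x₁ s₂) (𝒳.condKernel x₂ s₂) := by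
  have h1t : (s₁ : ℝ) ≤ t := h12.trans h2t
  haveI := 𝒳.isProbabilityMeasure_condKernel x₁ h1t
  haveI := 𝒳.isProbabilityMeasure_condKernel x₂ h1t
  haveI := 𝒳.isProbabilityMeasure_condKernel x₁ h2t
  haveI := 𝒳.isProbabilityMeasure_condKernel x₂ h2t
  haveI : SecondCountableTopology (𝒳.Slice s₁) := UniformSpace.secondCountable_of_separable _
  haveI : SecondCountableTopology (𝒳.Slice s₂) := UniformSpace.secondCountable_of_separable _
  have hne : Nonempty (𝒳.Slice s₁) := by
    by_contra hX
    rw [not_nonempty_iff] at hX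
    have h1 : 𝒳.condKernel x₁ s₁ univ = 1 := measure_univ
    rw [univ_eq_empty_iff.2 hX, measure_empty] at h1
    exact zero_ne_one h1
  obtain ⟨z₀⟩ := hne
  refine wassersteinW1_le_of_forall_integral_sub_le _ _ z₀
    (hH.lintegral_edist_condKernel_ne_top h1t x₁ z₀) (hH.lintegral_edist_condKernel_ne_top h1t x₂ z₀)
    fun w hwl hwb ↦ ?_
  obtain ⟨C, hC⟩ := hwb
  have hwm : Measurable w := hwl.continuous.measurable
  set u : 𝒳.Slice s₂ → ℝ := 𝒳.heatFlowOf s₁ w s₂ with hu_def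
  have hum : Measurable u := 𝒳.measurable_heatFlowOf h12 hwm
  have huC : ∀ y, |u y| ≤ C := fun y ↦ 𝒳.abs_heatFlowOf_le h12 hC y
  have hul : LipschitzWith 1 u := 𝒳.lipschitzWith_heatFlowOf h12 hwm hC hwl
  have hrep : ∀ x : 𝒳.Slice t,
      ∫ z, w z ∂(𝒳.condKernel x s₁) = ∫ y, u y ∂(𝒳.condKernel x s₂) := fun x ↦
    (𝒳.integral_integral_condKernel h12 h2t x hwm hC).symm
  rw [hrep x₁, hrep x₂]
  exact ofReal_integral_sub_integral_le_wassersteinW1 _ _ hum huC hul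

/-- **(b) without compactness**: the `W₁`-distance between two conjugate heat flows of finite
variance is non-decreasing in time. Printed proof: for a bounded `1`-Lipschitz `ũ` at time `t₁`,
its heat flow `u`, the gradient estimate (`u_{t₂}` is `1`-Lipschitz), the constancy of
`∫ u_t dμⁱ_t` and the easy inequality at `t₂`; then Kantorovich–Rubinstein at `t₁`.
[cite: Bamler2023, §3.2, Proposition (comparing two conjugate heat flows) (b)] -/
theorem IsConjugateHeatFlow.wassersteinW1_mono_of_variance_ne_top {I' : Set ℝ}
    {μ₁ μ₂ : ∀ t : I, Measure (𝒳.Slice t)} (hμ₁ : 𝒳.IsConjugateHeatFlow I' μ₁)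
    (hμ₂ : 𝒳.IsConjugateHeatFlow I' μ₂) {t₁ t₂ : I} (ht₁ : (t₁ : ℝ) ∈ I') (ht₂ : (t₂ : ℝ) ∈ I')
    (h : (t₁ : ℝ) ≤ t₂) (hV₁ : variance (μ₁ t₁) (μ₁ t₁) ≠ ∞) (hV₂ : variance (μ₂ t₁) (μ₂ t₁) ≠ ∞) :
    wassersteinW1 (μ₁ t₁) (μ₂ t₁) ≤ wassersteinW1 (μ₁ t₂) (μ₂ t₂) := by
  haveI := hμ₁.1 t₁ ht₁
  haveI := hμ₂.1 t₁ ht₁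
  haveI := hμ₁.1 t₂ ht₂
  haveI := hμ₂.1 t₂ ht₂
  haveI : SecondCountableTopology (𝒳.Slice t₁) := UniformSpace.secondCountable_of_separable _
  haveI : SecondCountableTopology (𝒳.Slice t₂) := UniformSpace.secondCountable_of_separable _
  have hne : Nonempty (𝒳.Slice t₁) := by
    by_contra hX
    rw [not_nonempty_iff] at hX
    have h1 : μ₁ t₁ univ = 1 := measure_univ
    rw [univ_eq_empty_iff.2 hX, measure_empty] at h1
    exact zero_ne_one h1
  obtain ⟨z₀⟩ := hne
  refine wassersteinW1_le_of_forall_integral_sub_le _ _ z₀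
    (lintegral_edist_ne_top_of_variance_ne_top _ hV₁ z₀)
    (lintegral_edist_ne_top_of_variance_ne_top _ hV₂ z₀) fun ζ hζl hζb ↦ ?_
  obtain ⟨C, hC⟩ := hζb
  have hζm : Measurable ζ := hζl.continuous.measurable
  set I'' : Set ℝ := I' ∩ Ici (t₁ : ℝ) with hI''
  have hu : 𝒳.IsHeatFlow I'' (𝒳.heatFlowOf t₁ ζ) :=
    𝒳.isHeatFlow_heatFlowOf (fun t ht ↦ ht.2) hζm hC
  have hres : ∀ {μ : ∀ t : I, Measure (𝒳.Slice t)}, 𝒳.IsConjugateHeatFlow I' μ →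
      𝒳.IsConjugateHeatFlow I'' μ := fun hμ ↦
    ⟨fun t ht ↦ hμ.1 t ht.1, fun s t hs ht hst ↦ hμ.2 hs.1 ht.1 hst⟩
  have h1 : (t₁ : ℝ) ∈ I'' := ⟨ht₁, Set.mem_Ici.2 le_rfl⟩
  have h2 : (t₂ : ℝ) ∈ I'' := ⟨ht₂, Set.mem_Ici.2 h⟩
  have hum : Measurable (𝒳.heatFlowOf t₁ ζ t₁) := 𝒳.measurable_heatFlowOf le_rfl hζm
  have huC : ∀ y, |𝒳.heatFlowOf t₁ ζ t₁ y| ≤ C := fun y ↦ 𝒳.abs_heatFlowOf_le le_rfl hC y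
  have hpair : ∀ {μ : ∀ t : I, Measure (𝒳.Slice t)}, 𝒳.IsConjugateHeatFlow I' μ →
      ∫ z, ζ z ∂(μ t₁) = ∫ y, 𝒳.heatFlowOf t₁ ζ t₂ y ∂(μ t₂) := by
    intro μ hμ
    have hp := hu.integral_eq_integral_of_isConjugateHeatFlow 𝒳 (hres hμ) h1 h2 h hum huC
    rw [heatFlowOf_self] at hp
    exact hp
  rw [hpair hμ₁, hpair hμ₂]
  exact ofReal_integral_sub_integral_le_wassersteinW1 _ _
    (𝒳.measurable_heatFlowOf h hζm) (fun y ↦ 𝒳.abs_heatFlowOf_le h hC y)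
    (𝒳.lipschitzWith_heatFlowOf h hζm hC hζl)

/-- **Distance shrinking for `H`-centers, no compactness** (Bamler 2023, §4, display before
§4.1): if `zᵢ ∈ 𝒳_s` is an `H`-center of `xᵢ ∈ 𝒳_t`, then
`d_s(z₁, z₂) ≤ d_t(x₁, x₂) + 2√(H(t − s))` (the compact version is `IsHCenter.edist_le_edist_add`;
the `H`-center bounds themselves give the finite first moments needed for (c)).
[cite: Bamler2023, §4, display before §4.1] -/
theorem IsHCenter.edist_le_edist_add' {H : ℝ} {s t : I} {x₁ x₂ : 𝒳.Slice t} {z₁ z₂ : 𝒳.Slice s}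
    (h₁ : 𝒳.IsHCenter H z₁ x₁) (h₂ : 𝒳.IsHCenter H z₂ x₂) :
    edist z₁ z₂ ≤ edist x₁ x₂ + 2 * (ENNReal.ofReal (H * ((t : ℝ) - s))) ^ (1 / 2 : ℝ) := by
  have hst : (s : ℝ) ≤ t := h₁.1
  haveI := 𝒳.isProbabilityMeasure_condKernel x₁ hst
  haveI := 𝒳.isProbabilityMeasure_condKernel x₂ hst
  haveI : SecondCountableTopology (𝒳.Slice s) := UniformSpace.secondCountable_of_separable _
  set ν₁ := 𝒳.condKernel x₁ s with hν₁
  set ν₂ := 𝒳.condKernel x₂ s with hν₂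
  set R : ℝ≥0∞ := (ENNReal.ofReal (H * ((t : ℝ) - s))) ^ (1 / 2 : ℝ) with hR
  have hA₁ : ∫⁻ y, edist z₁ y ∂ν₁ ≤ R := by
    have h := lintegral_lintegral_edist_le_sqrt_variance (Measure.dirac z₁) ν₁
    rw [lintegral_dirac] at h
    exact h.trans (ENNReal.rpow_le_rpow h₁.2 (by norm_num))
  have hA₂ : ∫⁻ y, edist y z₂ ∂ν₂ ≤ R := by
    have h := lintegral_lintegral_edist_le_sqrt_variance (Measure.dirac z₂) ν₂
    rw [lintegral_dirac] at h
    simp_rw [edist_comm _ z₂]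
    exact h.trans (ENNReal.rpow_le_rpow h₂.2 (by norm_num))
  have hq : ∀ q : {q : Measure (𝒳.Slice s × 𝒳.Slice s) // IsCoupling ν₁ ν₂ q},
      edist z₁ z₂ ≤ (∫⁻ y, edist z₁ y ∂ν₁ + ∫⁻ y, edist y z₂ ∂ν₂) +
        ∫⁻ p, edist p.1 p.2 ∂(q : Measure (𝒳.Slice s × 𝒳.Slice s)) := by
    rintro ⟨q, hqP, hq1, hq2⟩
    haveI := hqP
    have hm1 : Measurable fun p : 𝒳.Slice s × 𝒳.Slice s ↦ edist z₁ p.1 :=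
      measurable_const.edist measurable_fst
    have hm3 : Measurable fun p : 𝒳.Slice s × 𝒳.Slice s ↦ edist p.2 z₂ :=
      measurable_snd.edist measurable_const
    have hI1 : ∫⁻ p, edist z₁ p.1 ∂q = ∫⁻ y, edist z₁ y ∂ν₁ := by
      rw [← hq1, Measure.fst, lintegral_map
        (show Measurable fun y : 𝒳.Slice s ↦ edist z₁ y from measurable_const.edist measurable_id)
        measurable_fst]
    have hI3 : ∫⁻ p, edist p.2 z₂ ∂q = ∫⁻ y, edist y z₂ ∂ν₂ := by
      rw [← hq2, Measure.snd, lintegral_map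
        (show Measurable fun y : 𝒳.Slice s ↦ edist y z₂ from measurable_id.edist measurable_const)
        measurable_snd]
    calc edist z₁ z₂ = ∫⁻ _, edist z₁ z₂ ∂q := by rw [lintegral_const, measure_univ, mul_one]
      _ ≤ ∫⁻ p, edist z₁ p.1 + edist p.1 p.2 + edist p.2 z₂ ∂q :=
          lintegral_mono fun p ↦ edist_triangle4 _ _ _ _
      _ = ∫⁻ p, edist z₁ p.1 ∂q + ∫⁻ p, edist p.1 p.2 ∂q + ∫⁻ p, edist p.2 z₂ ∂q := by
          rw [lintegral_add_right _ hm3, lintegral_add_left hm1]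
      _ = (∫⁻ y, edist z₁ y ∂ν₁ + ∫⁻ y, edist y z₂ ∂ν₂) + ∫⁻ p, edist p.1 p.2 ∂q := by
          rw [hI1, hI3]; ring
  have hW : edist z₁ z₂ ≤ (∫⁻ y, edist z₁ y ∂ν₁ + ∫⁻ y, edist y z₂ ∂ν₂) + wassersteinW1 ν₁ ν₂ := by
    calc edist z₁ z₂ ≤ ⨅ q : {q : Measure (𝒳.Slice s × 𝒳.Slice s) // IsCoupling ν₁ ν₂ q},
        ((∫⁻ y, edist z₁ y ∂ν₁ + ∫⁻ y, edist y z₂ ∂ν₂) +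
          ∫⁻ p, edist p.1 p.2 ∂(q : Measure (𝒳.Slice s × 𝒳.Slice s))) := le_iInf hq
      _ = _ := ENNReal.add_iInf.symm
  -- (c) with base point `z₁`: both kernels have finite first moments
  have hm₁ : ∫⁻ y, edist z₁ y ∂ν₁ ≠ ∞ :=
    lintegral_edist_ne_top_of_variance_dirac_ne_top ν₁
      (ne_top_of_le_ne_top ENNReal.ofReal_ne_top h₁.2) z₁
  have hm₂ : ∫⁻ y, edist z₁ y ∂ν₂ ≠ ∞ :=
    lintegral_edist_ne_top_of_variance_dirac_ne_top ν₂
      (ne_top_of_le_ne_top ENNReal.ofReal_ne_top h₂.2) z₁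
  have hc : wassersteinW1 ν₁ ν₂ ≤ edist x₁ x₂ :=
    𝒳.wassersteinW1_condKernel_le_edist_of_ne_top hst x₁ x₂ z₁ hm₁ hm₂
  calc edist z₁ z₂ ≤ (∫⁻ y, edist z₁ y ∂ν₁ + ∫⁻ y, edist y z₂ ∂ν₂) + wassersteinW1 ν₁ ν₂ := hW
    _ ≤ (R + R) + edist x₁ x₂ := add_le_add (add_le_add hA₁ hA₂) hc
    _ = edist x₁ x₂ + 2 * R := by rw [two_mul, add_comm]

/-- **The first half of (4.3), no compactness**: in an `H`-concentrated flow, for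
`y₁, y₂ ∈ 𝒳_t`, `s ≤ t`, `∫∫ d_s dν_{y₁;s} dν_{y₂;s} ≤ d_t(y₁, y₂) + √(H(t − s))`.
[cite: Bamler2023, §4.2, Lemma (almost monotonicity), (4.3)] -/
theorem IsHConcentrated.lintegral_lintegral_edist_condKernel_le_edist' {H : ℝ}
    (hH : 𝒳.IsHConcentrated H) {s t : I} (hst : (s : ℝ) ≤ t) (y₁ y₂ : 𝒳.Slice t) :
    ∫⁻ x₁, ∫⁻ x₂, edist x₁ x₂ ∂(𝒳.condKernel y₂ s) ∂(𝒳.condKernel y₁ s) ≤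
      edist y₁ y₂ + (ENNReal.ofReal (H * ((t : ℝ) - s))) ^ (1 / 2 : ℝ) :=
  (hH.lintegral_lintegral_edist_condKernel_le hst y₁ y₂).trans
    (add_le_add (hH.wassersteinW1_condKernel_le_edist hst y₁ y₂) le_rfl)

end MetricFlow

end Literature.Geometry.Riemannian

end
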